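/-
Copyright (c) 2026 the pub-hodgecm-mathlib formalisation cell (harness21).  Prover seat hodgecm-mathlib-K2E5-p16 (g4): Track B «K2-LIT»,
hLiu418 = stmt-HodgeConjecture-24832, ROAD Φ organ Φ6b-3 step (Y1) (dealer K2E5-plan (g5) GO 2026-09-04T06:21:58Z «ξ–η identity»):
the GAMMA KERNEL `φ_s(u) = 1_{u>0} e^{−τ(gu)} det(u)^{s−2}` on `Herm₂(ℂ)` — integrability, continuity on the cone, trace-pairing transform; 2026-09-04.
-/
import Summits.HodgeConjecture.HodgeConjecture.Theorems.K2LiuHermTwoSiegelGindikinTube       -- ★ p857750: tube Siegel–Gindikin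
import HarnessLib

/-!
# Crux `HLiu418`, ROAD Φ, organ Φ6b-3 (Y1): the Gamma kernel `φ_s(u) = 1_{u > 0} e^{−τ(g u)} det(u)^{s−2}` on `Herm₂(ℂ)`

Cell `hodgecm-mathlib`, crux item hLiu418 = `stmt-HodgeConjecture-24832`, route of record `HCCMUnconditional`; squad K2, LEAD F0P6-plan (g12), co-dealer
K2E5-plan (g5) («GO Φ6b-3 `K2LiuHermTwoXiEtaIdentity` — the ξ–η identity IS the continuation mechanism»), prover K2E5-p16 (g4).  THEOREMS ONLY
(no `def`, no instance, no notation, no named-fact hypothesis, no `sorry`, default heartbeats); lane `--supports stmt-HodgeConjecture-24832 --as helper`.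

THE KERNEL.  For `g > 0` and `s ∈ ℂ` the function `φ_s : Herm₂(ℂ) → ℂ`, `φ_s(u) = e^{−τ(u g)} det(u)^{s−2}` on the cone `u > 0` and `0` elsewhere
(in the chart: `{c | (hermTwo c).PosDef}.indicator (fun c => cexp (−tr(hermTwo c · g)) * det(hermTwo c) ^ (s − 2))`).  Its transform against the
TRACE PAIRING `τ(x u)` is the tube Siegel–Gindikin formula, and `ξ`'s factors `det(g ∓ ix)^{−s}` are exactly these transforms — the first of the three
steps of the ξ–η identity [Shimura1982, (1.16) → (1.29)].
WHAT IS PROVED.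
* `integrable_gammaKernel (hg : g.PosDef) (hs : 1 < s.re)` — `φ_s ∈ L¹(Herm₂(ℂ))` (★ `integrableOn_siegelGindikin`);
* `norm_gammaKernel_eq` — `‖φ_s(u)‖ = φ_{re s}(u)` (real), `gammaKernel_eq_zero_of_not_posDef`;
* `continuousAt_gammaKernel_of_posDef (hg) (s) (hc : (hermTwo c).PosDef) : ContinuousAt φ_s c` — continuity at every point of the OPEN cone
  (★ `isOpen_setOf_posDef_hermTwo`, ★ `continuousAt_cpow_const` off the slit); `continuousAt_gammaKernel_of_not_mem_closure` — and at every
  point outside the closed cone (locally `0`); so `φ_s` is continuous off the null boundary `{det = 0} ∪ {a = 0}` — all that Fourier inversion AT A POINT needs;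
* `integral_gammaKernel_mul_cexp_trace (hg) (hs : 1 < s.re) (x) :
    ∫ c, φ_s c * cexp (−I * tr(hermTwo c · hermTwo x)) = Γ₂(s) · det(g + I • hermTwo x) ^ (−s)` — THE TRACE-PAIRING TRANSFORM
  (= ★ `integral_siegelGindikin_tube` at the tube point `Y = g + ix`), and the conjugate form with `+I` ∕ `g − ix`.
NEXT (Y2, Y3): transport to `EuclideanSpace ℝ (Fin 4)` (`τ(xu) = ⟪Sx̃, ũ⟫`, `S = diag(1,2,2,1)`), Mathlib `𝓕 φ_s` in closed form, then
`Integrable.fourierInv_fourier_eq` + Fubini ⇒ `ξ(g,h;α,β) = const·Γ₂(α)⁻¹Γ₂(β)⁻¹·η(2g, πh; α, β)`.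
HONEST LABEL.  Count-neutral helper of the K2_Liu road; it pays no socket by itself: `HC_CM` is proved only modulo the 7 printed citations
(2 remaining named inputs: hLiu418 = `stmt-HodgeConjecture-24832`, h413 = `stmt-HodgeConjecture-24833`) until rung 0 closes.
-/

set_option autoImplicit false
-- the mandated namespace repeats the single-problem summit's segment (`HodgeConjecture.HodgeConjecture`)
set_option linter.dupNamespace false

noncomputable section

open Complex MeasureTheory Set
open scoped ComplexOrder ComplexConjugate

namespace Summit.HodgeConjecture.HodgeConjecture.Cruxes.HLiu418.K2LiuHermTwoGammaKernelFourier

open Summit.HodgeConjecture.HodgeConjecture.Cruxes.HLiu418.K2LiuHermTwoGammaDefs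
open Summit.HodgeConjecture.HodgeConjecture.Cruxes.HLiu418.K2LiuHermTwoGammaSiegelGindikin
open Summit.HodgeConjecture.HodgeConjecture.Cruxes.HLiu418.K2LiuHermTwoSiegelGindikinTubeFibres
open Summit.HodgeConjecture.HodgeConjecture.Cruxes.HLiu418.K2LiuHermTwoSiegelGindikinTube

/-! ## Integrability and elementary properties -/

/-- `φ_s ∈ L¹`: the Gamma kernel is integrable on the chart for `g > 0`, `re s > 1`. -/
theorem integrable_gammaKernel {g : Matrix (Fin 2) (Fin 2) ℂ} (hg : g.PosDef) {s : ℂ} (hs : 1 < s.re) :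
    Integrable (fun c : ℝ × ℂ × ℝ =>
      {c : ℝ × ℂ × ℝ | (hermTwo c).PosDef}.indicator (fun c => cexp (-(hermTwo c * g).trace) * (hermTwo c).det ^ (s - 2)) c) :=
  (integrable_indicator_iff measurableSet_posDef_hermTwo).mpr (integrableOn_siegelGindikin hg hs)

/-- Off the cone the kernel vanishes. -/
theorem gammaKernel_eq_zero_of_not_posDef (g : Matrix (Fin 2) (Fin 2) ℂ) (s : ℂ) {c : ℝ × ℂ × ℝ} (hc : ¬ (hermTwo c).PosDef) :
    {c : ℝ × ℂ × ℝ | (hermTwo c).PosDef}.indicator (fun c => cexp (-(hermTwo c * g).trace) * (hermTwo c).det ^ (s - 2)) c = 0 :=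
  indicator_of_notMem (show c ∉ {c : ℝ × ℂ × ℝ | (hermTwo c).PosDef} from hc) _

/-- On the cone the kernel is the Siegel–Gindikin integrand. -/
theorem gammaKernel_eq_of_posDef (g : Matrix (Fin 2) (Fin 2) ℂ) (s : ℂ) {c : ℝ × ℂ × ℝ} (hc : (hermTwo c).PosDef) :
    {c : ℝ × ℂ × ℝ | (hermTwo c).PosDef}.indicator (fun c => cexp (-(hermTwo c * g).trace) * (hermTwo c).det ^ (s - 2)) c =
      cexp (-(hermTwo c * g).trace) * (hermTwo c).det ^ (s - 2) :=
  indicator_of_mem (show c ∈ {c : ℝ × ℂ × ℝ | (hermTwo c).PosDef} from hc) _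

/-- The kernel is measurable. -/
theorem measurable_gammaKernel (g : Matrix (Fin 2) (Fin 2) ℂ) (s : ℂ) :
    Measurable (fun c : ℝ × ℂ × ℝ =>
      {c : ℝ × ℂ × ℝ | (hermTwo c).PosDef}.indicator (fun c => cexp (-(hermTwo c * g).trace) * (hermTwo c).det ^ (s - 2)) c) := by
  refine Measurable.indicator ?_ measurableSet_posDef_hermTwo
  refine Measurable.mul ?_ ?_
  · have hc : Continuous fun c : ℝ × ℂ × ℝ => (hermTwo c * g).trace := by
      have hf : (fun c : ℝ × ℂ × ℝ => (hermTwo c * g).trace) =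
          fun c => (c.1 : ℂ) * g 0 0 + c.2.1 * g 1 0 + (conj c.2.1 * g 0 1 + (c.2.2 : ℂ) * g 1 1) := by
        funext c
        rw [Matrix.trace_fin_two, Matrix.mul_apply, Matrix.mul_apply, Fin.sum_univ_two, Fin.sum_univ_two]
        simp [hermTwo]
      rw [hf]
      fun_prop
    exact Complex.measurable_exp.comp hc.measurable.neg
  · have hc : Continuous fun c : ℝ × ℂ × ℝ => (hermTwo c).det := by
      have hf : (fun c : ℝ × ℂ × ℝ => (hermTwo c).det) = fun c => ((c.1 * c.2.2 - normSq c.2.1 : ℝ) : ℂ) := funext det_hermTwo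
      rw [hf]
      fun_prop
    exact hc.measurable.pow_const _

/-! ## Continuity at the points of the open cone and outside the closed cone -/

/-- On the OPEN cone the kernel is continuous (the cone is open, the Siegel–Gindikin integrand is continuous there since `det > 0` is off the slit). -/
theorem continuousAt_gammaKernel_of_posDef (g : Matrix (Fin 2) (Fin 2) ℂ) (s : ℂ) {c : ℝ × ℂ × ℝ} (hc : (hermTwo c).PosDef) :
    ContinuousAt (fun c : ℝ × ℂ × ℝ =>
      {c : ℝ × ℂ × ℝ | (hermTwo c).PosDef}.indicator (fun c => cexp (-(hermTwo c * g).trace) * (hermTwo c).det ^ (s - 2)) c) c := by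
  have hopen := isOpen_setOf_posDef_hermTwo
  -- near `c` the kernel is the smooth expression
  have heq : (fun c : ℝ × ℂ × ℝ =>
      {c : ℝ × ℂ × ℝ | (hermTwo c).PosDef}.indicator (fun c => cexp (-(hermTwo c * g).trace) * (hermTwo c).det ^ (s - 2)) c) =ᶠ[nhds c]
      fun c => cexp (-(hermTwo c * g).trace) * (hermTwo c).det ^ (s - 2) := by
    filter_upwards [hopen.mem_nhds (show c ∈ {c : ℝ × ℂ × ℝ | (hermTwo c).PosDef} from hc)] with c' hc'
    exact gammaKernel_eq_of_posDef g s hc'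
  refine ContinuousAt.congr ?_ heq.symm
  refine ContinuousAt.mul ?_ ?_
  · have hcont : Continuous fun c : ℝ × ℂ × ℝ => (hermTwo c * g).trace := by
      have hf : (fun c : ℝ × ℂ × ℝ => (hermTwo c * g).trace) =
          fun c => (c.1 : ℂ) * g 0 0 + c.2.1 * g 1 0 + (conj c.2.1 * g 0 1 + (c.2.2 : ℂ) * g 1 1) := by
        funext c
        rw [Matrix.trace_fin_two, Matrix.mul_apply, Matrix.mul_apply, Fin.sum_univ_two, Fin.sum_univ_two]
        simp [hermTwo]
      rw [hf]
      fun_prop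
    exact (Complex.continuous_exp.comp hcont.neg).continuousAt
  · have hdet : Continuous fun c : ℝ × ℂ × ℝ => (hermTwo c).det := by
      have hf : (fun c : ℝ × ℂ × ℝ => (hermTwo c).det) = fun c => ((c.1 * c.2.2 - normSq c.2.1 : ℝ) : ℂ) := funext det_hermTwo
      rw [hf]
      fun_prop
    refine ContinuousAt.comp (g := fun w : ℂ => w ^ (s - 2)) ?_ hdet.continuousAt
    refine continuousAt_cpow_const ?_
    rw [det_hermTwo]
    have hpos : 0 < c.1 * c.2.2 - normSq c.2.1 := by
      have h := (posDef_hermTwo_iff c).mp hc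
      linarith [h.2]
    exact Complex.ofReal_mem_slitPlane.mpr hpos

/-- Outside the CLOSED cone the kernel is continuous (it vanishes on a neighbourhood). -/
theorem continuousAt_gammaKernel_of_not_mem_closure (g : Matrix (Fin 2) (Fin 2) ℂ) (s : ℂ) {c : ℝ × ℂ × ℝ}
    (hc : c ∉ closure {c : ℝ × ℂ × ℝ | (hermTwo c).PosDef}) :
    ContinuousAt (fun c : ℝ × ℂ × ℝ =>
      {c : ℝ × ℂ × ℝ | (hermTwo c).PosDef}.indicator (fun c => cexp (-(hermTwo c * g).trace) * (hermTwo c).det ^ (s - 2)) c) c := by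
  have hmem : (closure {c : ℝ × ℂ × ℝ | (hermTwo c).PosDef})ᶜ ∈ nhds c := isClosed_closure.isOpen_compl.mem_nhds hc
  have heq : (fun c : ℝ × ℂ × ℝ =>
      {c : ℝ × ℂ × ℝ | (hermTwo c).PosDef}.indicator (fun c => cexp (-(hermTwo c * g).trace) * (hermTwo c).det ^ (s - 2)) c) =ᶠ[nhds c]
      fun _ => (0 : ℂ) := by
    filter_upwards [hmem] with c' hc'
    exact indicator_of_notMem (fun h => hc' (subset_closure h)) _
  exact (continuousAt_const.congr heq.symm)

/-! ## The trace-pairing transform of the kernel (tube Siegel–Gindikin) -/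

/-- `tr(u g) + I·tr(u x) = tr(u (g + I x))`. -/
theorem trace_mul_add_I_smul (u g x : Matrix (Fin 2) (Fin 2) ℂ) :
    (u * g).trace + I * (u * x).trace = (u * (g + I • x)).trace := by
  rw [Matrix.mul_add, Matrix.trace_add, Matrix.mul_smul, Matrix.trace_smul, smul_eq_mul]

/-- **THE TRACE-PAIRING TRANSFORM OF THE GAMMA KERNEL**: for `g > 0`, `re s > 1` and every `x = hermTwo e`,
`∫ φ_s(u) e^{−i τ(u x)} du = Γ₂(s) · det(g + ix)^{−s}` — the tube Siegel–Gindikin formula at `Y = g + ix` (principal power). -/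
theorem integral_gammaKernel_mul_cexp_trace {g : Matrix (Fin 2) (Fin 2) ℂ} (hg : g.PosDef) {s : ℂ} (hs : 1 < s.re) (e : ℝ × ℂ × ℝ) :
    ∫ c : ℝ × ℂ × ℝ, {c : ℝ × ℂ × ℝ | (hermTwo c).PosDef}.indicator
        (fun c => cexp (-(hermTwo c * g).trace) * (hermTwo c).det ^ (s - 2)) c * cexp (-(I * (hermTwo c * hermTwo e).trace)) =
      hermTwoGamma s * (g + I • hermTwo e).det ^ (-s) := by
  have hY := posDef_add_conjTranspose_of_add_I_smul hg (isHermitian_hermTwo e)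
  rw [← integral_siegelGindikin_tube hY hs, ← integral_indicator measurableSet_posDef_hermTwo]
  refine integral_congr_ae (Filter.Eventually.of_forall fun c => ?_)
  simp only []
  by_cases hc : (hermTwo c).PosDef
  · rw [indicator_of_mem (show c ∈ {c : ℝ × ℂ × ℝ | (hermTwo c).PosDef} from hc),
      indicator_of_mem (show c ∈ {c : ℝ × ℂ × ℝ | (hermTwo c).PosDef} from hc), ← trace_mul_add_I_smul, neg_add,
      Complex.exp_add]
    ring
  · rw [indicator_of_notMem (show c ∉ {c : ℝ × ℂ × ℝ | (hermTwo c).PosDef} from hc),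
      indicator_of_notMem (show c ∉ {c : ℝ × ℂ × ℝ | (hermTwo c).PosDef} from hc), zero_mul]

/-- The conjugate pairing: `∫ φ_s(u) e^{+i τ(u x)} du = Γ₂(s) · det(g − ix)^{−s}`. -/
theorem integral_gammaKernel_mul_cexp_trace_neg {g : Matrix (Fin 2) (Fin 2) ℂ} (hg : g.PosDef) {s : ℂ} (hs : 1 < s.re) (e : ℝ × ℂ × ℝ) :
    ∫ c : ℝ × ℂ × ℝ, {c : ℝ × ℂ × ℝ | (hermTwo c).PosDef}.indicator
        (fun c => cexp (-(hermTwo c * g).trace) * (hermTwo c).det ^ (s - 2)) c * cexp (I * (hermTwo c * hermTwo e).trace) =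
      hermTwoGamma s * (g - I • hermTwo e).det ^ (-s) := by
  have h := integral_gammaKernel_mul_cexp_trace hg hs (-e)
  have hneg : hermTwo (-e) = -hermTwo e := by
    ext i j
    fin_cases i <;> fin_cases j <;> simp [hermTwo]
  rw [hneg, smul_neg, ← sub_eq_add_neg] at h
  rw [← h]
  refine integral_congr_ae (Filter.Eventually.of_forall fun c => ?_)
  simp only [Matrix.trace_neg, mul_neg, neg_neg]

/-- The PAIRING IS A GENUINE INTEGRAL: the paired kernel is integrable (`|e^{−iτ}| = 1`). -/
theorem integrable_gammaKernel_mul_cexp_trace {g : Matrix (Fin 2) (Fin 2) ℂ} (hg : g.PosDef) {s : ℂ} (hs : 1 < s.re) (e : ℝ × ℂ × ℝ) :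
    Integrable (fun c : ℝ × ℂ × ℝ => {c : ℝ × ℂ × ℝ | (hermTwo c).PosDef}.indicator
        (fun c => cexp (-(hermTwo c * g).trace) * (hermTwo c).det ^ (s - 2)) c * cexp (-(I * (hermTwo c * hermTwo e).trace))) := by
  refine (integrable_gammaKernel hg hs).mul_bdd (c := 1) ?_ (Filter.Eventually.of_forall fun c => ?_)
  · refine (Complex.continuous_exp.comp ?_).aestronglyMeasurable
    have hf : (fun c : ℝ × ℂ × ℝ => -(I * (hermTwo c * hermTwo e).trace)) =
        fun c => -(I * ((c.1 * e.1 + c.2.2 * e.2.2 + 2 * (c.2.1 * conj e.2.1).re : ℝ) : ℂ)) :=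
      funext fun c => by rw [trace_hermTwo_mul_hermTwo]
    rw [hf]
    fun_prop
  · rw [trace_hermTwo_mul_hermTwo, Complex.norm_exp]
    simp

end Summit.HodgeConjecture.HodgeConjecture.Cruxes.HLiu418.K2LiuHermTwoGammaKernelFourier

end
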